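import Summits.NavierStokesRegularity.NavierStokesRegularity.Theses.HardyPointSink
import Summits.NavierStokesRegularity.NavierStokesRegularity.Theorems.HardyPointSinkHardyEnergyBoundLedger
import Summits.NavierStokesRegularity.NavierStokesRegularity.Theorems.HardyPointSinkHardyEnergyBoundLocalHardyIdentity
import Summits.NavierStokesRegularity.NavierStokesRegularity.Theorems.HardyPointSinkHardyEnergyBoundSolenoidalHardyFlux
import Summits.NavierStokesRegularity.NavierStokesRegularity.Theorems.HardyPointSinkHardyEnergyBoundSpaceTimeL3
import Summits.NavierStokesRegularity.NavierStokesRegularity.Theorems.HardyPointSinkHardyEnergyBoundConverseCutoff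
import HarnessLib

/-!
# Route HardyPointSink — `HardyEnergyBound`, line `birth`: the converse CRUX ⇒ HEART

Item stmt-NavierStokesRegularity-7979 (crux `Theses.HardyPointSink.HardyEnergyBound`), registered
anchor `hardyEnergyBound_influxAbsorption_of_crux`. The line `birth` proves the crux from the
localised Hardy LEDGER `H + D ≤ C + ofReal(−2I)` (`stub_hardyLedger_of`) and the HEART
`ofReal(−2I) ≤ D + M` (influx absorption). This file proves the converse: the crux implies the
heart, so that the heart is exactly crux-sized.

Proof. From the crux at the centre `xs` get `r₀, K` with `∫_{B(xs,r₀)} |u(t)|²/|x − x₀| ≤ K` for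
`x₀ ∈ B(xs, r₀)`, `T − r₀² < t < T`; take `R = min(r₀/2, √T/2)`. For a sink `x₀ ∈ B(xs, R/4)` use the
plateau cut-off of the ledger CENTRED AT THE SINK with scale `R/4`: `φ = 1` on `B̄(x₀, R/8)`, `φ`
supported in `B̄(x₀, R/4) ⊆ B(xs, R/2)`, so that every slice tool of the ledger files applies verbatim
(`xs := x₀`), the cut-off derivatives live where `|x − x₀| ≥ R/8`, and their sup norms do not depend on
`x₀` (translation). The localised identity (`stub_localHardyIdentity`) between `T − R²` and `t`, the
pressure swap `p = Π[v s] + c(s)` (`stub_solenoidalHardyFlux` kills `c`) and the space–time `L³` bound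
(`stub_spaceTimeL3`) give, in `ℝ`,
`−2I = H_φ(t) − H_φ(T−R²) + D_φ − ∫Φ ≤ H_φ(t) + D_φ + |∫Φ|`, `|∫Φ| ≤ αR² + β∫∫|v|³`;
finally `ofReal H_φ(t) ≤ ∫⁻_{B(xs,r₀)} |u(t)|²/|x − x₀| ≤ K` by the crux (`φ ≤ 1_{B(xs,r₀)}`,
`v t = u t` a.e.) and `ofReal D_φ ≤ D` (`φ ≤ 1_{B(xs,R/2)}`, `φ(x₀) = 1`), with no continuity needed on
the `ℝ≥0∞` side (`ofReal ∫ ≤ ∫⁻ ofReal`).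
-/

noncomputable section

open MeasureTheory Set Filter Topology Metric Function
open scoped ENNReal NNReal InnerProductSpace Laplacian

set_option linter.dupNamespace false -- nested layout Summit.<S>.<Sub>, Sub = S (D-0017)

namespace Summit.NavierStokesRegularity.NavierStokesRegularity.Theorems

open Literature.Analysis.FluidPDE Literature.Analysis.PDE

/-! ### The converse: CRUX ⇒ HEART -/

/-- **Anchor `hardyEnergyBound_influxAbsorption_of_crux` of line `birth` (crux `HardyEnergyBound`):
the crux implies the heart.** If the local Hardy energy of every Kato solution stays bounded up to
`T`, then for the classical representative `(v, p)` the sharp head influx toward every sink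
`x₀ ∈ B(xs, R/4)` over `[T − R², t]` is absorbed by the localised Hardy dissipation plus a constant,
uniformly in `x₀` and `t < T`. -/
theorem hardyEnergyBound_influxAbsorption_of_crux :
    Summit.NavierStokesRegularity.NavierStokesRegularity.Theses.HardyPointSink.HardyEnergyBound →
    ∀ ν : ℝ, 0 < ν → ∀ u₀ : EuclideanSpace ℝ (Fin 3) → EuclideanSpace ℝ (Fin 3),
      ContDiff ℝ (⊤ : ℕ∞) u₀ → Literature.Analysis.FluidPDE.NSWave0.IsDivFree u₀ →
      Literature.Analysis.FluidPDE.HasRapidSpatialDecay u₀ →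
      ∀ (T : ℝ) (u : ℝ → EuclideanSpace ℝ (Fin 3) → EuclideanSpace ℝ (Fin 3)), 0 < T →
      Literature.Analysis.FluidPDE.IsKatoSolutionOn T ν u₀ u →
      ∀ (v : ℝ → EuclideanSpace ℝ (Fin 3) → EuclideanSpace ℝ (Fin 3))
        (p : ℝ → EuclideanSpace ℝ (Fin 3) → ℝ),
      Literature.Analysis.FluidPDE.IsClassicalNSSolutionOn (Set.Ioo 0 T) ν 0 v p →
      (∀ t ∈ Set.Ioo 0 T, v t =ᵐ[MeasureTheory.volume] u t) →
      ∀ xs : EuclideanSpace ℝ (Fin 3), ∃ R : ℝ, 0 < R ∧ R ^ 2 < T ∧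
      ∃ M : NNReal, ∀ x₀ ∈ Metric.ball xs (R / 4), ∀ t ∈ Set.Ico (T - R ^ 2) T,
        ENNReal.ofReal (-2 * ∫ s in (T - R ^ 2)..t, ∫ x in Metric.ball xs R,
              (‖v s x‖ ^ 2 / 2 + Literature.Analysis.FluidPDE.rieszPressure (v s) x)
                * inner ℝ (v s x) (x - x₀) / ‖x - x₀‖ ^ 3)
        ≤ (∫⁻ s in Set.Ioo (T - R ^ 2) t,
              (ENNReal.ofReal (2 * ν)
                  * (∫⁻ x in Metric.ball xs (R / 2),
                      ENNReal.ofReal (Literature.Analysis.FluidPDE.frobeniusNormSq (fderiv ℝ (v s) x))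
                        / ‖x - x₀‖ₑ)
                + ENNReal.ofReal (4 * Real.pi * ν) * ‖v s x₀‖ₑ ^ 2))
          + (M : ENNReal) := by
  intro hE ν hν u₀ hsm hdiv hdec T u hT hu v p hcl hae xs
  -- the crux at the centre `xs`
  obtain ⟨r₀, hr₀, K, hK⟩ := hE ν hν u₀ hsm hdiv hdec T u hT hu xs
  -- the scale `R < r₀`, `R² < T`
  set R : ℝ := min (r₀ / 2) (Real.sqrt T / 2) with hRdef
  have hR : 0 < R := lt_min (by positivity) (by positivity)
  have hRr : R < r₀ := (min_le_left _ _).trans_lt (by linarith)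
  have hRT : R ^ 2 < T := by
    have h1 : R ≤ Real.sqrt T / 2 := min_le_right _ _
    have h2 : R ^ 2 ≤ (Real.sqrt T / 2) ^ 2 := pow_le_pow_left₀ hR.le h1 2
    have h3 : (Real.sqrt T / 2) ^ 2 = T / 4 := by rw [div_pow, Real.sq_sqrt hT.le]; norm_num
    nlinarith
  refine ⟨R, hR, hRT, ?_⟩
  -- basic facts on the strip
  have hIoo : IsOpen (Ioo (0 : ℝ) T) := isOpen_Ioo
  have ha0 : 0 < T - R ^ 2 := by linarith
  have hsm_v : IsSmoothSpaceTimeOn (Ioo 0 T) v := hcl.smooth_velocity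
  have hsm_p : IsSmoothSpaceTimeOn (Ioo 0 T) p := hcl.smooth_pressure
  have hvc : ∀ s ∈ Ioo 0 T, Continuous (v s) := fun s hs => (hcl.contDiff_velocity hs).continuous
  have hpc : ∀ s ∈ Ioo 0 T, Continuous (p s) := fun s hs => (hcl.contDiff_pressure hs).continuous
  have hv3 : ∀ s ∈ Ioo 0 T, MemLp (v s) 3 volume := fun s hs =>
    hardyEnergyBound_ledger_memLp_three hu hae hs
  -- the cut-off scale `R/4` and the centre-independent constants
  have hρ : 0 < R / 4 := by positivity
  obtain ⟨L₁, L₂, hL₁0, hL₂0, hL₁, hL₂⟩ := hardyEnergyBound_converse_exists_bounds hρ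
  set V : ℝ := (volume : Measure (EuclideanSpace ℝ (Fin 3))).real
    (closedBall (0 : EuclideanSpace ℝ (Fin 3)) (R / 4)) with hV
  set Cst : ℝ := (steinConstThreeHalves : ℝ) with hCst
  have hV0 : 0 ≤ V := measureReal_nonneg
  have hCst0 : 0 ≤ Cst := NNReal.coe_nonneg _
  set aA : ℝ := |ν| * (L₂ * (4 / (R / 4)) + 2 * L₁ * (16 / (R / 4) ^ 2)) with haA
  set aB : ℝ := 4 * L₁ / (R / 4) * (1 + 2 * Cst) with haB
  set aD : ℝ := 16 / (R / 4) ^ 2 * (1 / 2 + Cst) with haD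
  have haA0 : 0 ≤ aA := by positivity
  have haB0 : 0 ≤ aB := by positivity
  have haD0 : 0 ≤ aD := by positivity
  set α : ℝ := aA * V with hα
  set β : ℝ := aA + aB + 2 * aD with hβ
  have hα0 : 0 ≤ α := by positivity
  have hβ0 : 0 ≤ β := by positivity
  -- the space–time `L³` bound
  have hfin : ∫⁻ s in Ioo (T - R ^ 2) T, ∫⁻ x, ‖v s x‖ₑ ^ 3 < ⊤ :=
    hardyEnergyBound_ledger_lintegral_lintegral_lt_top
      (hsm_v.continuousOn.mono (prod_mono (Ioo_subset_Ioo_left ha0.le) Subset.rfl))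
      (stub_spaceTimeL3 ν hν T u₀ u hT hu v p hcl hae (T - R ^ 2) ha0 (by nlinarith))
  set N : ℝ≥0∞ := ∫⁻ s in Ioo (T - R ^ 2) T, ∫⁻ x, ‖v s x‖ₑ ^ 3 with hN
  set C₁ : ℝ≥0∞ := ENNReal.ofReal α * ENNReal.ofReal (R ^ 2) + ENNReal.ofReal β * N with hC₁
  have hC₁top : C₁ ≠ ⊤ := ENNReal.add_ne_top.2 ⟨ENNReal.mul_ne_top ENNReal.ofReal_ne_top
    ENNReal.ofReal_ne_top, ENNReal.mul_ne_top ENNReal.ofReal_ne_top hfin.ne⟩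
  have hMtop : (K : ℝ≥0∞) + C₁ ≠ ⊤ := ENNReal.add_ne_top.2 ⟨ENNReal.coe_ne_top, hC₁top⟩
  refine ⟨((K : ℝ≥0∞) + C₁).toNNReal, ?_⟩
  intro x₀ hx₀ t ht
  rw [ENNReal.coe_toNNReal hMtop]
  obtain ⟨ht1, htT⟩ := ht
  have hx₀d : dist x₀ xs < R / 4 := mem_ball.1 hx₀
  -- the plateau cut-off CENTRED AT THE SINK, scale `R/4`
  set φ := hardyEnergyBound_ledger_cutoff x₀ hρ with hφ
  have hx₀' : x₀ ∈ ball x₀ (R / 4 / 4) := mem_ball_self (by positivity)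
  have hφs : ContDiff ℝ (⊤ : ℕ∞) φ := hardyEnergyBound_ledger_cutoff_contDiff x₀ hρ
  have hφc : HasCompactSupport φ := hardyEnergyBound_ledger_cutoff_hasCompactSupport x₀ hρ
  have hL₁x : ∀ x, ‖fderiv ℝ φ x‖ ≤ L₁ := hL₁ x₀
  have hL₂x : ∀ x, |(Δ φ) x| ≤ L₂ := hL₂ x₀
  have hsub2 : ball x₀ (R / 4) ⊆ ball xs (R / 2) := fun x hx => by
    rw [mem_ball] at hx ⊢
    linarith [dist_triangle x x₀ xs]
  have hsubR : ball x₀ (R / 4) ⊆ ball xs R :=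
    hsub2.trans (ball_subset_ball (by linarith))
  have hsubr : ball x₀ (R / 4) ⊆ ball xs r₀ :=
    hsub2.trans (ball_subset_ball (by linarith))
  have hφ2 : ∀ x ∉ ball xs (R / 2), φ x = 0 := fun x hx => by
    by_contra h
    exact hx (hsub2 (hardyEnergyBound_ledger_mem_ball_of_cutoff_ne_zero x₀ hρ h))
  have hφr : ∀ x ∉ ball xs r₀, φ x = 0 := fun x hx => by
    by_contra h
    exact hx (hsubr (hardyEnergyBound_ledger_mem_ball_of_cutoff_ne_zero x₀ hρ h))
  have hVx : (volume : Measure (EuclideanSpace ℝ (Fin 3))).real (closedBall x₀ (R / 4)) = V := by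
    rw [hV, measureReal_def, measureReal_def, Measure.addHaar_closedBall_center]
  -- the time window `K = [T - R², t]` inside `(0, S')`, `S' = (t + T)/2`
  set S' : ℝ := (t + T) / 2 with hS'
  have htS' : t < S' := by rw [hS']; linarith
  have hS'T : S' < T := by rw [hS']; linarith
  have hKT : Icc (T - R ^ 2) t ⊆ Ioo 0 T := fun s hs => ⟨ha0.trans_le hs.1, hs.2.trans_lt htT⟩
  have hKS' : Icc (T - R ^ 2) t ⊆ Ioo 0 S' := fun s hs => ⟨ha0.trans_le hs.1, hs.2.trans_lt htS'⟩
  have hKc : IsCompact (Icc (T - R ^ 2) t) := isCompact_Icc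
  have hUI : uIcc (T - R ^ 2) t = Icc (T - R ^ 2) t := uIcc_of_le ht1
  -- pressure normalisation on `(0, S')`
  have hcl' : IsClassicalNSSolutionOn (Ioo 0 S') ν 0 v p :=
    hcl.mono (Ioo_subset_Ioo_right hS'T.le) isOpen_Ioo.uniqueDiffOn
  obtain ⟨Mv, hMv⟩ := (hu.continuousInLpOn.mono (fun s hs => ⟨hs.1, hs.2.trans_lt hS'T⟩ :
    Icc 0 S' ⊆ Ico 0 T)).exists_forall_eLpNorm_le_Icc
  have hMv' : ∀ s ∈ Ioo 0 S', eLpNorm (v s) 3 volume ≤ Mv := fun s hs => by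
    rw [eLpNorm_congr_ae (hae s ⟨hs.1, hs.2.trans hS'T⟩)]
    exact hMv s ⟨hs.1.le, hs.2.le⟩
  have hex : ∀ s, ∃ c : ℝ, s ∈ Ioo 0 S' →
      ∀ᵐ x ∂(volume : Measure (EuclideanSpace ℝ (Fin 3))), p s x = rieszPressure (v s) x + c := by
    intro s
    by_cases hs : s ∈ Ioo 0 S'
    · obtain ⟨c, hc⟩ := PressureNormalisationL3.pressure_ae_eq_rieszPressure_add_const hν.le hcl'
        (fun s hs => hv3 s ⟨hs.1, hs.2.trans hS'T⟩) hMv' hs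
      exact ⟨c, fun _ => hc⟩
    · exact ⟨0, fun h => absurd h hs⟩
  choose c hc using hex
  have hcK : ∀ s ∈ Icc (T - R ^ 2) t, ∀ᵐ x ∂(volume : Measure (EuclideanSpace ℝ (Fin 3))),
      p s x = rieszPressure (v s) x + c s := fun s hs => hc s (hKS' hs)
  -- the solenoidal flux identity on each slice
  have hsol : ∀ s ∈ Ioo 0 T, ∫ x, fderiv ℝ φ x (v s x) / ‖x - x₀‖ =
      ∫ x, φ x * inner ℝ (v s x) (x - x₀) / ‖x - x₀‖ ^ 3 := fun s hs =>
    stub_solenoidalHardyFlux (v s) (hcl.contDiff_velocity hs) (hcl.divFree s hs) φ hφs hφc x₀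
  -- the time functions
  set G : ℝ → ℝ := fun s => ∫ x, (hardyEnergyBound_ledgerA ν φ (v s) x₀ x +
    hardyEnergyBound_ledgerB φ (v s) (p s) x₀ x - hardyEnergyBound_ledgerC φ (v s) (p s) x₀ x) with hG
  set F : ℝ → ℝ := fun s => ∫ x in ball xs R,
    hardyEnergyBound_ledgerFlux (v s) (rieszPressure (v s)) x₀ x with hF
  set Φ : ℝ → ℝ := fun s => (∫ x, hardyEnergyBound_ledgerA ν φ (v s) x₀ x) +
    (∫ x, hardyEnergyBound_ledgerB φ (v s) (rieszPressure (v s)) x₀ x) -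
    2 * (∫ x in ball xs R, (φ x - 1) * hardyEnergyBound_ledgerFlux (v s) (rieszPressure (v s)) x₀ x)
    with hΦ
  set X : ℝ → ℝ := fun s => ∫ x, φ x * frobeniusNormSq (fderiv ℝ (v s) x) / ‖x - x₀‖ with hX
  set Y : ℝ → ℝ := fun s => ‖v s x₀‖ ^ 2 with hY
  -- (1) slice by slice: `G = Φ - 2F` and `|Φ| ≤ α + β ∫|v s|³`
  have hGΦ : ∀ s ∈ Icc (T - R ^ 2) t, G s = Φ s - 2 * F s := fun s hs => by
    have hsI := hKT hs
    have e : G s = (∫ x, hardyEnergyBound_ledgerA ν φ (v s) x₀ x) +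
        (∫ x, hardyEnergyBound_ledgerB φ (v s) (rieszPressure (v s)) x₀ x) -
        2 * (∫ x in ball x₀ (R / 4), (φ x - 1) *
          hardyEnergyBound_ledgerFlux (v s) (rieszPressure (v s)) x₀ x) -
        2 * (∫ x in ball x₀ (R / 4), hardyEnergyBound_ledgerFlux (v s) (rieszPressure (v s)) x₀ x) :=
      hardyEnergyBound_ledger_pressure_swap hρ hx₀' hL₁0 hL₂0 hL₁x hL₂x (hvc s hsI) (hv3 s hsI) ν
        (hpc s hsI) (hcK s hs) (hsol s hsI)
    have h1 := hardyEnergyBound_converse_influx_collect (c := x₀) (x₀ := x₀) (xs := x₀)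
      (R := R / 4) hρ Subset.rfl (hvc s hsI) (hpc s hsI) (hcK s hs)
    have h2 := hardyEnergyBound_converse_influx_collect (x₀ := x₀) hρ hsubR (hvc s hsI)
      (hpc s hsI) (hcK s hs)
    have eΦ : Φ s = (∫ x, hardyEnergyBound_ledgerA ν φ (v s) x₀ x) +
        (∫ x, hardyEnergyBound_ledgerB φ (v s) (rieszPressure (v s)) x₀ x) -
        2 * (∫ x in ball xs R, (φ x - 1) *
          hardyEnergyBound_ledgerFlux (v s) (rieszPressure (v s)) x₀ x) := rfl
    have eF : F s = ∫ x in ball xs R, hardyEnergyBound_ledgerFlux (v s) (rieszPressure (v s)) x₀ x :=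
      rfl
    rw [e, eΦ, eF]
    linarith
  have hΦb : ∀ s ∈ Icc (T - R ^ 2) t, |Φ s| ≤ α + β * ∫ x, ‖v s x‖ ^ 3 := fun s hs => by
    have hw := hvc s (hKT hs)
    have hw3 := hv3 s (hKT hs)
    have h1 := hardyEnergyBound_ledger_abs_integral_ledgerA_le hρ hx₀' hL₁0 hL₂0 hL₁x hL₂x hw hw3 ν
    rw [hVx] at h1
    have h2 := hardyEnergyBound_ledger_abs_integral_ledgerB_le hρ hx₀' hL₁0 hL₁x hw hw3
    have h3 := hardyEnergyBound_converse_abs_integral_deficit_le hρ hx₀' hw3 (ball xs R)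
    have hN0 : 0 ≤ ∫ x, ‖v s x‖ ^ 3 := integral_nonneg fun x => by positivity
    calc |Φ s| ≤ |∫ x, hardyEnergyBound_ledgerA ν φ (v s) x₀ x| +
          |∫ x, hardyEnergyBound_ledgerB φ (v s) (rieszPressure (v s)) x₀ x| +
          2 * |∫ x in ball xs R, (φ x - 1) *
            hardyEnergyBound_ledgerFlux (v s) (rieszPressure (v s)) x₀ x| := by
          refine (abs_sub _ _).trans (add_le_add (abs_add_le _ _) ?_)
          rw [abs_mul, abs_two]
      _ ≤ aA * (V + ∫ x, ‖v s x‖ ^ 3) + aB * (∫ x, ‖v s x‖ ^ 3) + 2 * (aD * ∫ x, ‖v s x‖ ^ 3) :=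
          add_le_add (add_le_add h1 h2) (mul_le_mul_of_nonneg_left h3 zero_le_two)
      _ = α + β * ∫ x, ‖v s x‖ ^ 3 := by rw [hα, hβ]; ring
  -- (2) continuity in time on `K` of `G` and `F`
  have hGc : ContinuousOn G (Icc (T - R ^ 2) t) :=
    hardyEnergyBound_ledger_continuousOn_rhs hρ hx₀' hL₁0 hL₂0 hL₁x hL₂x hKc hKT hsm_v hsm_p ν
  have hFc : ContinuousOn F (Icc (T - R ^ 2) t) := by
    have hcc : ContinuousOn c (Icc (T - R ^ 2) t) :=
      hardyEnergyBound_ledger_continuousOn_const hu hae hS'T hKS' hKc hsm_p hcK xs hR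
    have h := (hardyEnergyBound_ledger_continuousOn_influx (x₀ := x₀) (xs := xs) (R := R) hKc hKT
      hsm_v hsm_p).sub (hcc.mul (hardyEnergyBound_ledger_continuousOn_moment (x₀ := x₀) (xs := xs)
        (R := R) hKc hKT hsm_v))
    refine h.congr fun s hs => ?_
    exact hardyEnergyBound_ledger_influx_eq (hvc s (hKT hs)) (hpc s (hKT hs)) (hcK s hs) x₀ xs R
  have hGi : IntervalIntegrable G volume (T - R ^ 2) t := (hGc.mono hUI.subset).intervalIntegrable
  have hFi : IntervalIntegrable F volume (T - R ^ 2) t := (hFc.mono hUI.subset).intervalIntegrable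
  -- (3) the identity between `T - R²` and `t`
  have hId : (∫ x, φ x * ‖v t x‖ ^ 2 / ‖x - x₀‖) - (∫ x, φ x * ‖v (T - R ^ 2) x‖ ^ 2 / ‖x - x₀‖) +
      2 * ν * (∫ s in (T - R ^ 2)..t, X s) + 4 * Real.pi * ν * φ x₀ * (∫ s in (T - R ^ 2)..t, Y s) =
      ∫ s in (T - R ^ 2)..t, G s :=
    stub_localHardyIdentity (Ioo 0 T) ν v p hIoo hcl φ hφs hφc x₀ (T - R ^ 2) t ht1 hKT
  have hφ1 : φ x₀ = 1 := hardyEnergyBound_ledger_cutoff_sink x₀ hρ hx₀'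
  rw [hφ1, mul_one] at hId
  have hIG : (∫ s in (T - R ^ 2)..t, G s) + 2 * (∫ s in (T - R ^ 2)..t, F s) =
      ∫ s in (T - R ^ 2)..t, Φ s := by
    rw [← intervalIntegral.integral_const_mul, ← intervalIntegral.integral_add hGi (hFi.const_mul 2)]
    refine intervalIntegral.integral_congr fun s hs => ?_
    rw [hUI] at hs
    simp only [hGΦ s hs]
    ring
  -- (4) the bound `ofReal (−∫Φ) ≤ C₁`
  have hΦe : ∀ s ∈ Icc (T - R ^ 2) t, ‖Φ s‖ₑ ≤ ENNReal.ofReal α + ENNReal.ofReal β * ∫⁻ x, ‖v s x‖ₑ ^ 3 :=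
    fun s hs => by
    have hN0 : 0 ≤ ∫ x, ‖v s x‖ ^ 3 := integral_nonneg fun x => by positivity
    rw [Real.enorm_eq_ofReal_abs, ← hardyEnergyBound_ledger_ofReal_integral_cube (hv3 s (hKT hs)),
      ← ENNReal.ofReal_mul hβ0, ← ENNReal.ofReal_add hα0 (mul_nonneg hβ0 hN0)]
    exact ENNReal.ofReal_le_ofReal (hΦb s hs)
  have hIΦ : ENNReal.ofReal (-(∫ s in (T - R ^ 2)..t, Φ s)) ≤ C₁ := by
    rw [intervalIntegral.integral_of_le ht1]
    calc ENNReal.ofReal (-(∫ s in Ioc (T - R ^ 2) t, Φ s))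
        ≤ ‖∫ s in Ioc (T - R ^ 2) t, Φ s‖ₑ := by
          rw [Real.enorm_eq_ofReal_abs]; exact ENNReal.ofReal_le_ofReal (neg_le_abs _)
      _ ≤ ∫⁻ s in Ioc (T - R ^ 2) t, ‖Φ s‖ₑ := enorm_integral_le_lintegral_enorm _
      _ ≤ ∫⁻ s in Ioc (T - R ^ 2) t, (ENNReal.ofReal α + ENNReal.ofReal β * ∫⁻ x, ‖v s x‖ₑ ^ 3) :=
          setLIntegral_mono' measurableSet_Ioc fun s hs => hΦe s (Ioc_subset_Icc_self hs)
      _ ≤ ∫⁻ s in Ioo (T - R ^ 2) T, (ENNReal.ofReal α + ENNReal.ofReal β * ∫⁻ x, ‖v s x‖ₑ ^ 3) :=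
          lintegral_mono_set (Ioc_subset_Ioo_right htT)
      _ = ENNReal.ofReal α * volume (Ioo (T - R ^ 2) T) + ENNReal.ofReal β * N := by
          rw [lintegral_add_left' aemeasurable_const, lintegral_const_mul' _ _ ENNReal.ofReal_ne_top,
            setLIntegral_const]
      _ = C₁ := by
          rw [hC₁, Real.volume_Ioo]
          congr 2
          congr 1
          ring
  -- (5) the Hardy energy at time `t` against the crux
  have hH : ENNReal.ofReal (∫ x, φ x * ‖v t x‖ ^ 2 / ‖x - x₀‖) ≤ (K : ℝ≥0∞) := by
    have htI : t ∈ Ioo 0 T := hKT ⟨ht1, le_rfl⟩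
    have hx₀r : x₀ ∈ ball xs r₀ := mem_ball.2 (by linarith)
    have htr : T - r₀ ^ 2 < t := by
      have : R ^ 2 < r₀ ^ 2 := pow_lt_pow_left₀ hRr hR.le two_ne_zero
      linarith
    have hKt := hK x₀ hx₀r t ⟨ha0.le.trans ht1, htT⟩ htr
    calc ENNReal.ofReal (∫ x, φ x * ‖v t x‖ ^ 2 / ‖x - x₀‖)
        ≤ ∫⁻ x, ENNReal.ofReal (φ x * ‖v t x‖ ^ 2 / ‖x - x₀‖) :=
          ofReal_integral_le_lintegral_ofReal _
      _ ≤ ∫⁻ x, (ball xs r₀).indicator (fun x => ENNReal.ofReal (‖v t x‖ ^ 2) / ‖x - x₀‖ₑ) x :=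
          lintegral_mono fun x => hardyEnergyBound_converse_ofReal_weighted_le
            (hardyEnergyBound_ledger_cutoff_le_one x₀ hρ) hφr (fun x => by positivity) x₀ x
      _ = ∫⁻ x in ball xs r₀, ENNReal.ofReal (‖v t x‖ ^ 2) / ‖x - x₀‖ₑ :=
          lintegral_indicator measurableSet_ball _
      _ = ∫⁻ x in ball xs r₀, ‖u t x‖ₑ ^ 2 / ‖x - x₀‖ₑ := by
          refine lintegral_congr_ae ?_
          filter_upwards [ae_restrict_of_ae (s := ball xs r₀) (hae t htI)] with x hx
          rw [ENNReal.ofReal_pow (norm_nonneg _), ofReal_norm, hx]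
      _ ≤ K := hKt
  -- (6) the dissipation against the heart's `ℝ≥0∞` dissipation
  have hXs : ∀ s, ENNReal.ofReal (X s) ≤ ∫⁻ x in ball xs (R / 2),
      ENNReal.ofReal (frobeniusNormSq (fderiv ℝ (v s) x)) / ‖x - x₀‖ₑ := fun s =>
    calc ENNReal.ofReal (X s)
        ≤ ∫⁻ x, ENNReal.ofReal (φ x * frobeniusNormSq (fderiv ℝ (v s) x) / ‖x - x₀‖) :=
          ofReal_integral_le_lintegral_ofReal _
      _ ≤ ∫⁻ x, (ball xs (R / 2)).indicator
            (fun x => ENNReal.ofReal (frobeniusNormSq (fderiv ℝ (v s) x)) / ‖x - x₀‖ₑ) x :=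
          lintegral_mono fun x => hardyEnergyBound_converse_ofReal_weighted_le
            (hardyEnergyBound_ledger_cutoff_le_one x₀ hρ) hφ2 (fun x => frobeniusNormSq_nonneg _) x₀ x
      _ = _ := lintegral_indicator measurableSet_ball _
  have hYs : ∀ s, ENNReal.ofReal (Y s) = ‖v s x₀‖ₑ ^ 2 := fun s => by
    rw [show Y s = ‖v s x₀‖ ^ 2 from rfl, ENNReal.ofReal_pow (norm_nonneg _), ofReal_norm]
  have hD : ENNReal.ofReal (2 * ν * (∫ s in (T - R ^ 2)..t, X s) +
      4 * Real.pi * ν * (∫ s in (T - R ^ 2)..t, Y s)) ≤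
      ∫⁻ s in Ioo (T - R ^ 2) t, (ENNReal.ofReal (2 * ν) *
        (∫⁻ x in ball xs (R / 2), ENNReal.ofReal (frobeniusNormSq (fderiv ℝ (v s) x)) / ‖x - x₀‖ₑ) +
        ENNReal.ofReal (4 * Real.pi * ν) * ‖v s x₀‖ₑ ^ 2) := by
    have h2ν : (0 : ℝ) ≤ 2 * ν := by positivity
    have h4ν : (0 : ℝ) ≤ 4 * Real.pi * ν := by positivity
    rw [intervalIntegral.integral_of_le ht1, intervalIntegral.integral_of_le ht1,
      integral_Ioc_eq_integral_Ioo, integral_Ioc_eq_integral_Ioo]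
    calc ENNReal.ofReal (2 * ν * (∫ s in Ioo (T - R ^ 2) t, X s) +
          4 * Real.pi * ν * (∫ s in Ioo (T - R ^ 2) t, Y s))
        ≤ ENNReal.ofReal (2 * ν * ∫ s in Ioo (T - R ^ 2) t, X s) +
          ENNReal.ofReal (4 * Real.pi * ν * ∫ s in Ioo (T - R ^ 2) t, Y s) := ENNReal.ofReal_add_le
      _ ≤ ENNReal.ofReal (2 * ν) * (∫⁻ s in Ioo (T - R ^ 2) t, ENNReal.ofReal (X s)) +
          ENNReal.ofReal (4 * Real.pi * ν) * (∫⁻ s in Ioo (T - R ^ 2) t, ENNReal.ofReal (Y s)) := by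
          rw [ENNReal.ofReal_mul h2ν, ENNReal.ofReal_mul h4ν]
          exact add_le_add (mul_le_mul' le_rfl (ofReal_integral_le_lintegral_ofReal _))
            (mul_le_mul' le_rfl (ofReal_integral_le_lintegral_ofReal _))
      _ = (∫⁻ s in Ioo (T - R ^ 2) t, ENNReal.ofReal (2 * ν) * ENNReal.ofReal (X s)) +
          ∫⁻ s in Ioo (T - R ^ 2) t, ENNReal.ofReal (4 * Real.pi * ν) * ENNReal.ofReal (Y s) := by
          rw [lintegral_const_mul' _ _ ENNReal.ofReal_ne_top, lintegral_const_mul' _ _ ENNReal.ofReal_ne_top]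
      _ ≤ ∫⁻ s in Ioo (T - R ^ 2) t, (ENNReal.ofReal (2 * ν) * ENNReal.ofReal (X s) +
          ENNReal.ofReal (4 * Real.pi * ν) * ENNReal.ofReal (Y s)) := le_lintegral_add _ _
      _ ≤ _ := lintegral_mono fun s => by
          rw [hYs s]
          exact add_le_add (mul_le_mul' le_rfl (hXs s)) le_rfl
  -- (7) assembly in `ℝ`, then in `ℝ≥0∞`
  have hHt1 : 0 ≤ ∫ x, φ x * ‖v (T - R ^ 2) x‖ ^ 2 / ‖x - x₀‖ := integral_nonneg fun x =>
    div_nonneg (mul_nonneg (hardyEnergyBound_ledger_cutoff_nonneg x₀ hρ x) (by positivity)) (norm_nonneg _)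
  change ENNReal.ofReal (-2 * ∫ s in (T - R ^ 2)..t, F s) ≤ _
  have hkey : -2 * (∫ s in (T - R ^ 2)..t, F s) ≤ (∫ x, φ x * ‖v t x‖ ^ 2 / ‖x - x₀‖) +
      (2 * ν * (∫ s in (T - R ^ 2)..t, X s) + 4 * Real.pi * ν * (∫ s in (T - R ^ 2)..t, Y s)) +
      (-(∫ s in (T - R ^ 2)..t, Φ s)) := by
    linarith [hId, hIG, hHt1]
  calc ENNReal.ofReal (-2 * ∫ s in (T - R ^ 2)..t, F s)
      ≤ ENNReal.ofReal ((∫ x, φ x * ‖v t x‖ ^ 2 / ‖x - x₀‖) +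
          (2 * ν * (∫ s in (T - R ^ 2)..t, X s) + 4 * Real.pi * ν * (∫ s in (T - R ^ 2)..t, Y s)) +
          (-(∫ s in (T - R ^ 2)..t, Φ s))) := ENNReal.ofReal_le_ofReal hkey
    _ ≤ ENNReal.ofReal ((∫ x, φ x * ‖v t x‖ ^ 2 / ‖x - x₀‖) +
          (2 * ν * (∫ s in (T - R ^ 2)..t, X s) + 4 * Real.pi * ν * (∫ s in (T - R ^ 2)..t, Y s))) +
        ENNReal.ofReal (-(∫ s in (T - R ^ 2)..t, Φ s)) := ENNReal.ofReal_add_le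
    _ ≤ ENNReal.ofReal (∫ x, φ x * ‖v t x‖ ^ 2 / ‖x - x₀‖) +
          ENNReal.ofReal (2 * ν * (∫ s in (T - R ^ 2)..t, X s) +
            4 * Real.pi * ν * (∫ s in (T - R ^ 2)..t, Y s)) +
        ENNReal.ofReal (-(∫ s in (T - R ^ 2)..t, Φ s)) := add_le_add ENNReal.ofReal_add_le le_rfl
    _ ≤ (K : ℝ≥0∞) + (∫⁻ s in Ioo (T - R ^ 2) t, (ENNReal.ofReal (2 * ν) *
          (∫⁻ x in ball xs (R / 2), ENNReal.ofReal (frobeniusNormSq (fderiv ℝ (v s) x)) / ‖x - x₀‖ₑ) +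
          ENNReal.ofReal (4 * Real.pi * ν) * ‖v s x₀‖ₑ ^ 2)) + C₁ :=
        add_le_add (add_le_add hH hD) hIΦ
    _ = _ := by ring

end Summit.NavierStokesRegularity.NavierStokesRegularity.Theorems

end
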